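/-
Copyright (c) 2026 the pub-hodgecm-mathlib formalisation cell (harness21).  Prover seat hodgecm-mathlib-K2E3-p11 (g10) (valve hand), Track B «K2-LIT»,
#184♮ = hLiu418 = `stmt-HodgeConjecture-24832`; socket #41, KIND W — LEAD F0P6-plan (g14) BATCH #176 (1) 2026-09-04T23:56:27Z «FILE W1 = PAYER of
LH4-p08's `hKpic` K-PICTURE OF A TRANSLATE»; statement = the `hKpic` binder of LH4-p08 (g11)'s SIG v1 `K2LiuKindWArchWhittakerLetter` (b055403af9da5e84
:60–:67) with `(k : ℤ) (Q : Carrier)` explicit; KW desk F0P2-p08 (g3).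
THEOREMS ONLY (no `def`, no `instance`, no notation, no named-fact hypothesis, no `sorry`).
-/
import Summits.HodgeConjecture.HodgeConjecture.Theorems.K2LiuU22ShilovCoordinate      -- ★ `apply_eq_mul_apply_kU`, `conjTranspose_shilov_mul`, `denom_I_eq_blocks`
import Summits.HodgeConjecture.HodgeConjecture.Theorems.K2LiuU22CompactPictureDefs    -- ★ `Carrier`, `detPoly`, `evalAt`, `evalAt_algebraMap`, `aeval_detPoly`
import Summits.HodgeConjecture.HodgeConjecture.Theorems.K2LiuSiegelStabBlocks         -- ★ `toBlocks_of_stab`, `cayley_mem_unitaryGroup`, `denom_I_of_stab`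
import HarnessLib

/-!
# Crux `HLiu418`, socket #41, KIND W — `K2LiuKindWArchWhittakerKPicture`: THE K-PICTURE OF A `Stab(i1)`-TRANSLATE OF A SIEGEL SECTION

Cell `hodgecm-mathlib`, crux item hLiu418 = `stmt-HodgeConjecture-24832` (helper lane `--supports`, count-neutral).  PAYER of the ONE algebraic
bridge `hKpic` that ★-to-be `K2LiuKindWArchWhittakerLetter.exists_twistedWhittaker_continuation_of_posDef` (LH4-p08) takes BY VALUE:
«for `k₀ ∈ K_w = Stab_{U(J)}(i1)` there is ONE polynomial `P` in the entries `u_{pq}` and their conjugates such that EVERY section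
`F ∈ I_w(s, χ_k)` (any `s`) whose compact picture on the Shilov coset section `v ↦ k_v` is the carrier element `Q ∈ ℂ[v_{ij}, det(v)⁻¹]`
satisfies `F(u·k₀) = P(u, ū)` for all `u ∈ K_w`» — the K-picture hypothesis (iii) of ★ JUNCTION `kFiniteSection_whittaker_holomorphy_growth`
for the right translate `F(·k₀)`.

THE COMPUTATION (tube frame of record `U(J)`, `J = (0 −1; 1 0)`, base point `i1`; [Shimura1997, §16.4], [Knapp1986, Ch. VII §1]).
For `h ∈ K_w`: `h = (A B; −B A)` (★ `eq_fromBlocks_of_stab`) with CAYLEY COMPONENTS `c₁ = A + iB`, `c₂ = A − iB` both unitary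
(★ `cayley_mem_unitaryGroup`); the two automorphy matrices are `D⁻ = denom h (−i1) = c₁` (§2 `denom_negI_of_stab`) and `D⁺ = denom h (i1) = c₂`
(★ `denom_I_of_stab`), so the Shilov coordinate is `v(h) = D⁻⁻¹D⁺ = c₁ᴴ c₂ ∈ U(2)` and ★ `apply_eq_mul_apply_kU` reads
`F h = χ_k(det (c₁⁻¹)ᴴ) · ‖det (c₁⁻¹)ᴴ‖^{2s+2} · F(k_{v(h)}) = conj(det c₁)^k · Q(v(h))` — the `s`-dependence DIES on `K_w` (`‖det c₁‖ = 1`).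
Writing `Q = P₁ ∕ D^n` (`IsLocalization.surj`) and using `det(v)⁻¹ = conj det v` on `U(2)`:
**`F h = conj(det c₁)^k · P₁(c₁ᴴc₂) · conj(det (c₁ᴴc₂))^n`** (§2 `apply_of_stab_eq`) — visibly a polynomial in the entries of `h` and `h̄`
(`k < 0`: `conj(det c₁)^k = (det c₁)^{−k}`).  §3 types the SYMBOLIC version of this closed form over `MvPolynomial σ ℂ` for ANY pair of symbolic
matrices `(MU, MC)` evaluating to `(h, h̄)` (`eval_closedFormPoly`), and §4 instantiates it at `MU = X·k₀`, `MC = X̄·k̄₀` (the translate is a LINEAR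
substitution, done inside the symbolic matrices — no `bind₁`).
* §1 scalar letters of a unitary matrix (`conj det · det = 1`, `‖det‖ = 1`, `det⁻¹ = conj det`, `χ_k(det) = conj(det)^k`);
* §2 the closed form of a section on `K_w` (`denom_negI_of_stab`, `evalAt_eq_of_unitary`, `apply_of_stab_eq`);
* §3 symbolic Cayley components and their evaluation (`Matrix.map` of the ring hom `MvPolynomial.eval x`, `RingHom.map_det`, `Matrix.map_mul`);
* §4 HEAD `kPicture_rightTranslate` — token-identical to the SIG's `hKpic` binder after `(k) (Q)`.
References: [Shimura1997] G. Shimura, *Euler Products and Eisenstein Series*, §16.4 (sections of `I(s, χ)` and their `K`-types);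
[Knapp1986] A. Knapp, *Representation Theory of Semisimple Groups*, Ch. VII §1 (compact picture).
HONEST LABEL: HC_CM is proved only modulo the 7 printed citations (2 remaining named inputs: hLiu418 = stmt-HodgeConjecture-24832,
h413 = stmt-HodgeConjecture-24833) until rung 0 closes; count-neutral helper, closes no socket.
-/

set_option autoImplicit false
set_option linter.dupNamespace false -- the mandated namespace repeats `HodgeConjecture.HodgeConjecture`

noncomputable section

open Complex Matrix
open scoped ComplexConjugate

namespace Summit.HodgeConjecture.HodgeConjecture.Cruxes.HLiu418.K2LiuKindWArchWhittakerKPicture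

open Literature.NumberTheory.ModularForms.SiegelUpperHalfSpace (denom moeb denom_def)
open Summit.HodgeConjecture.HodgeConjecture.Cruxes.HLiu418.K2LiuHermitianTubeCocycle (mul_mem_UJ)
open Summit.HodgeConjecture.HodgeConjecture.Cruxes.HLiu418.K2LiuArchInducedTubeDefs
open Summit.HodgeConjecture.HodgeConjecture.Cruxes.HLiu418.K2LiuU22CompactPictureDefs
open Summit.HodgeConjecture.HodgeConjecture.Cruxes.HLiu418.K2LiuU22ShilovCoordinate
open Summit.HodgeConjecture.HodgeConjecture.Cruxes.HLiu418.K2LiuSiegelStabBlocks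

/-! ## §1 Scalar letters of a unitary matrix -/

/-- `conj(det c) · det c = 1` for `cᴴ c = 1` (determinant of `cᴴ c = 1`). [folklore] -/
theorem conj_det_mul_det_eq_one {n : Type*} [Fintype n] [DecidableEq n] {c : Matrix n n ℂ} (hc : cᴴ * c = 1) :
    conj c.det * c.det = 1 := by
  have h := congrArg Matrix.det hc
  rwa [det_mul, det_conjTranspose, det_one, Complex.star_def] at h

/-- `det c ≠ 0` for `cᴴ c = 1`. [folklore] -/
theorem det_ne_zero_of_unitary {n : Type*} [Fintype n] [DecidableEq n] {c : Matrix n n ℂ} (hc : cᴴ * c = 1) : c.det ≠ 0 :=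
  right_ne_zero_of_mul_eq_one (conj_det_mul_det_eq_one hc)

/-- `det(c)⁻¹ = conj(det c)` for `cᴴ c = 1`. [folklore] -/
theorem inv_det_eq_conj {n : Type*} [Fintype n] [DecidableEq n] {c : Matrix n n ℂ} (hc : cᴴ * c = 1) : (c.det)⁻¹ = conj c.det :=
  inv_eq_of_mul_eq_one_left (conj_det_mul_det_eq_one hc)

/-- `‖det c‖ = 1` for `cᴴ c = 1`. [folklore] -/
theorem norm_det_eq_one {n : Type*} [Fintype n] [DecidableEq n] {c : Matrix n n ℂ} (hc : cᴴ * c = 1) : ‖c.det‖ = 1 := by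
  have h : ‖conj c.det * c.det‖ = 1 := by rw [conj_det_mul_det_eq_one hc, norm_one]
  rw [norm_mul, Complex.norm_conj] at h
  have h0 : 0 ≤ ‖c.det‖ := norm_nonneg _
  nlinarith [h, h0]

/-- `conj(det c)^k` as an honest power for `k < 0`: `conj(det c)^{−m} = (det c)^m` when `conj(det c) · det c = 1`. [folklore] -/
theorem conj_det_zpow_neg {z : ℂ} (hz : conj z * z = 1) (m : ℕ) : conj z ^ (-(m : ℤ)) = z ^ m := by
  rw [eq_inv_of_mul_eq_one_left hz, _root_.zpow_neg, zpow_natCast, inv_pow, inv_inv]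

/-! ## §2 The closed form of a Siegel section on the stabiliser `K_w` -/

/-- On the stabiliser, `denom h (−i1) = A + iB` — the FIRST Cayley component (`h = (A B; −B A)`, ★ `toBlocks_of_stab`). [cite: Shimura1997, §16.4] -/
theorem denom_negI_of_stab {l : Type*} [Fintype l] [DecidableEq l] {u : Matrix (l ⊕ l) (l ⊕ l) ℂ}
    (hu : uᴴ * Matrix.J l ℂ * u = Matrix.J l ℂ) (hI : moeb u (I • (1 : Matrix l l ℂ)) = I • 1) :
    denom u (-(I • (1 : Matrix l l ℂ))) = u.toBlocks₁₁ + I • u.toBlocks₁₂ := by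
  obtain ⟨hC, hD⟩ := toBlocks_of_stab hu hI
  rw [(denom_I_eq_blocks u).2, hC, hD, smul_neg, sub_neg_eq_add]

/-- **Evaluation of a carrier element at a unitary matrix is polynomial in `(v, v̄)`**: if `Q · D^n = P₁` in `𝒜 = ℂ[u, D⁻¹]` then
`ev_v Q = P₁(v) · conj(det v)^n` for `vᴴ v = 1` (`det(v)⁻¹ = conj det v`). [cite: Knapp1986, Ch. VII §1] -/
theorem evalAt_eq_of_unitary {v : Matrix (Fin 2) (Fin 2) ℂ} (hv : vᴴ * v = 1) (hv0 : v.det ≠ 0) {Q : Carrier}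
    {P₁ : MvPolynomial (Fin 2 × Fin 2) ℂ} {n : ℕ}
    (hP₁ : Q * algebraMap (MvPolynomial (Fin 2 × Fin 2) ℂ) Carrier (detPoly ^ n) = algebraMap (MvPolynomial (Fin 2 × Fin 2) ℂ) Carrier P₁) :
    evalAt v hv0 Q = MvPolynomial.aeval (fun kl : Fin 2 × Fin 2 => v kl.1 kl.2) P₁ * conj v.det ^ n := by
  have h := congrArg (evalAt v hv0) hP₁
  rw [map_mul, evalAt_algebraMap, evalAt_algebraMap, map_pow, aeval_detPoly] at h
  rw [← inv_det_eq_conj hv, inv_pow]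
  exact (eq_mul_inv_iff_mul_eq₀ (pow_ne_zero n hv0)).2 h

/-- **THE CLOSED FORM OF A SECTION ON `K_w`.**  For `F ∈ I_w(s, χ_k)` with compact picture `Q = P₁ ∕ D^n` on the coset section `k_v` and
`u = (A B; −B A) ∈ Stab_{U(J)}(i1)` with Cayley components `c₁ = A + iB`, `c₂ = A − iB`:
`F u = conj(det c₁)^k · P₁(c₁ᴴ c₂) · conj(det(c₁ᴴ c₂))^n` — independent of `s` (★ `apply_eq_mul_apply_kU`: `D⁻ = c₁`, `v(u) = c₁⁻¹c₂ = c₁ᴴc₂`,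
multiplier `χ_k(det (c₁⁻¹)ᴴ)·‖det (c₁⁻¹)ᴴ‖^{2s+2} = conj(det c₁)^k`). [cite: Shimura1997, §16.4] [cite: Knapp1986, Ch. VII §1] -/
theorem apply_of_stab_eq {k : ℤ} {s : ℂ} {F : Matrix (Fin 2 ⊕ Fin 2) (Fin 2 ⊕ Fin 2) ℂ → ℂ}
    (hF : IsArchSiegelSection (fun z : ℂ => (conj z / ((‖z‖ : ℝ) : ℂ)) ^ k) s F) {Q : Carrier}
    (hQ : ∀ (v : Matrix (Fin 2) (Fin 2) ℂ), vᴴ * v = 1 → ∀ hv : v.det ≠ 0,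
      F ((2 : ℂ)⁻¹ • fromBlocks (1 + v) (-(I • (1 - v))) (I • (1 - v)) (1 + v) : Matrix (Fin 2 ⊕ Fin 2) (Fin 2 ⊕ Fin 2) ℂ) = evalAt v hv Q)
    {P₁ : MvPolynomial (Fin 2 × Fin 2) ℂ} {n : ℕ}
    (hP₁ : Q * algebraMap (MvPolynomial (Fin 2 × Fin 2) ℂ) Carrier (detPoly ^ n) = algebraMap (MvPolynomial (Fin 2 × Fin 2) ℂ) Carrier P₁)
    {u : Matrix (Fin 2 ⊕ Fin 2) (Fin 2 ⊕ Fin 2) ℂ} (hu : uᴴ * Matrix.J (Fin 2) ℂ * u = Matrix.J (Fin 2) ℂ)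
    (hI : moeb u (I • (1 : Matrix (Fin 2) (Fin 2) ℂ)) = I • 1) :
    F u = conj (u.toBlocks₁₁ + I • u.toBlocks₁₂).det ^ k *
      (MvPolynomial.aeval (fun kl : Fin 2 × Fin 2 => ((u.toBlocks₁₁ + I • u.toBlocks₁₂)ᴴ * (u.toBlocks₁₁ - I • u.toBlocks₁₂)) kl.1 kl.2) P₁ *
        conj ((u.toBlocks₁₁ + I • u.toBlocks₁₂)ᴴ * (u.toBlocks₁₁ - I • u.toBlocks₁₂)).det ^ n) := by
  have hD1 : denom u (-(I • (1 : Matrix (Fin 2) (Fin 2) ℂ))) = u.toBlocks₁₁ + I • u.toBlocks₁₂ := denom_negI_of_stab hu hI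
  have hD2 : denom u (I • (1 : Matrix (Fin 2) (Fin 2) ℂ)) = u.toBlocks₁₁ - I • u.toBlocks₁₂ := denom_I_of_stab hu hI
  obtain ⟨hc₁, -⟩ := cayley_mem_unitaryGroup hu hI
  have hc₁' : (u.toBlocks₁₁ + I • u.toBlocks₁₂)ᴴ * (u.toBlocks₁₁ + I • u.toBlocks₁₂) = 1 := by
    have h := Matrix.mem_unitaryGroup_iff'.1 hc₁
    rwa [star_eq_conjTranspose] at h
  have hinv : (u.toBlocks₁₁ + I • u.toBlocks₁₂)⁻¹ = (u.toBlocks₁₁ + I • u.toBlocks₁₂)ᴴ := inv_eq_left_inv hc₁'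
  -- the Shilov coordinate `v(u) = c₁ᴴ c₂` is unitary
  have hv : ((u.toBlocks₁₁ + I • u.toBlocks₁₂)ᴴ * (u.toBlocks₁₁ - I • u.toBlocks₁₂))ᴴ *
      ((u.toBlocks₁₁ + I • u.toBlocks₁₂)ᴴ * (u.toBlocks₁₁ - I • u.toBlocks₁₂)) = 1 := by
    have h := conjTranspose_shilov_mul hu
    rwa [hD1, hD2, hinv] at h
  have hv0 := det_ne_zero_of_unitary hv
  -- the compact-picture factorisation, read on the stabiliser
  have h1 := apply_eq_mul_apply_kU hF hu
  rw [hD1, hD2, hinv, conjTranspose_conjTranspose, hQ _ hv hv0, evalAt_eq_of_unitary hv hv0 hP₁, norm_det_eq_one hc₁', Complex.ofReal_one,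
    div_one, Complex.one_cpow, mul_one] at h1
  exact h1

/-! ## §3 Symbolic Cayley components over `MvPolynomial σ ℂ` and their evaluation -/

section Symbolic

variable {σ : Type*} (x : σ → ℂ) (MU MC : Matrix (Fin 2 ⊕ Fin 2) (Fin 2 ⊕ Fin 2) (MvPolynomial σ ℂ))
  (h : Matrix (Fin 2 ⊕ Fin 2) (Fin 2 ⊕ Fin 2) ℂ)

/-- evaluation of the symbolic FIRST Cayley component `A + iB`. [folklore] -/
theorem map_eval_cayleyFst (hU : MU.map (MvPolynomial.eval x) = h) :
    (MU.toBlocks₁₁ + (MvPolynomial.C I : MvPolynomial σ ℂ) • MU.toBlocks₁₂).map (MvPolynomial.eval x) = h.toBlocks₁₁ + I • h.toBlocks₁₂ := by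
  subst hU
  ext m i
  simp [Matrix.toBlocks₁₁, Matrix.toBlocks₁₂, MvPolynomial.eval_C]

/-- evaluation of the symbolic SECOND Cayley component `A − iB`. [folklore] -/
theorem map_eval_cayleySnd (hU : MU.map (MvPolynomial.eval x) = h) :
    (MU.toBlocks₁₁ - (MvPolynomial.C I : MvPolynomial σ ℂ) • MU.toBlocks₁₂).map (MvPolynomial.eval x) = h.toBlocks₁₁ - I • h.toBlocks₁₂ := by
  subst hU
  ext m i
  simp [Matrix.toBlocks₁₁, Matrix.toBlocks₁₂, MvPolynomial.eval_C]

/-- evaluation of the symbolic CONJUGATE first Cayley component `Ā − iB̄ = conj(A + iB)`. [folklore] -/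
theorem map_eval_cayleyFst_conj (hC : MC.map (MvPolynomial.eval x) = h.map (starRingEnd ℂ)) :
    (MC.toBlocks₁₁ - (MvPolynomial.C I : MvPolynomial σ ℂ) • MC.toBlocks₁₂).map (MvPolynomial.eval x) = (h.toBlocks₁₁ + I • h.toBlocks₁₂).map (starRingEnd ℂ) := by
  ext m i
  have h1 : MvPolynomial.eval x (MC (Sum.inl m) (Sum.inl i)) = conj (h (Sum.inl m) (Sum.inl i)) := by
    simpa [Matrix.map_apply] using congrFun (congrFun hC (Sum.inl m)) (Sum.inl i)
  have h2 : MvPolynomial.eval x (MC (Sum.inl m) (Sum.inr i)) = conj (h (Sum.inl m) (Sum.inr i)) := by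
    simpa [Matrix.map_apply] using congrFun (congrFun hC (Sum.inl m)) (Sum.inr i)
  simp [Matrix.toBlocks₁₁, Matrix.toBlocks₁₂, MvPolynomial.eval_C, h1, h2, Complex.conj_I, sub_eq_add_neg]

/-- evaluation of the symbolic CONJUGATE second Cayley component `Ā + iB̄ = conj(A − iB)`. [folklore] -/
theorem map_eval_cayleySnd_conj (hC : MC.map (MvPolynomial.eval x) = h.map (starRingEnd ℂ)) :
    (MC.toBlocks₁₁ + (MvPolynomial.C I : MvPolynomial σ ℂ) • MC.toBlocks₁₂).map (MvPolynomial.eval x) = (h.toBlocks₁₁ - I • h.toBlocks₁₂).map (starRingEnd ℂ) := by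
  ext m i
  have h1 : MvPolynomial.eval x (MC (Sum.inl m) (Sum.inl i)) = conj (h (Sum.inl m) (Sum.inl i)) := by
    simpa [Matrix.map_apply] using congrFun (congrFun hC (Sum.inl m)) (Sum.inl i)
  have h2 : MvPolynomial.eval x (MC (Sum.inl m) (Sum.inr i)) = conj (h (Sum.inl m) (Sum.inr i)) := by
    simpa [Matrix.map_apply] using congrFun (congrFun hC (Sum.inl m)) (Sum.inr i)
  simp [Matrix.toBlocks₁₁, Matrix.toBlocks₁₂, MvPolynomial.eval_C, h1, h2, Complex.conj_I, sub_eq_add_neg]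

/-- `(c₁.map conj)ᵀ · c₂ = c₁ᴴ · c₂` (the conjugate transpose is the transpose of the entrywise conjugate). [folklore] -/
theorem transpose_map_conj_mul (c₁ c₂ : Matrix (Fin 2) (Fin 2) ℂ) : (c₁.map (starRingEnd ℂ))ᵀ * c₂ = c₁ᴴ * c₂ := by
  congr 1

/-- `c₁ᵀ · (c₂.map conj) = (c₁ᴴ · c₂).map conj`. [folklore] -/
theorem transpose_mul_map_conj (c₁ c₂ : Matrix (Fin 2) (Fin 2) ℂ) :
    c₁ᵀ * c₂.map (starRingEnd ℂ) = (c₁ᴴ * c₂).map (starRingEnd ℂ) := by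
  rw [Matrix.map_mul]
  congr 1
  ext i j
  simp [Matrix.conjTranspose_apply, Matrix.transpose_apply, Matrix.map_apply]

/-- **EVALUATION OF THE SYMBOLIC SHILOV COORDINATE**: `(Ā − iB̄)ᵀ(A − iB) ↦ c₁ᴴ c₂`. [cite: Knapp1986, Ch. VII §1] -/
theorem map_eval_shilov (hU : MU.map (MvPolynomial.eval x) = h) (hC : MC.map (MvPolynomial.eval x) = h.map (starRingEnd ℂ)) :
    ((MC.toBlocks₁₁ - (MvPolynomial.C I : MvPolynomial σ ℂ) • MC.toBlocks₁₂)ᵀ * (MU.toBlocks₁₁ - (MvPolynomial.C I : MvPolynomial σ ℂ) • MU.toBlocks₁₂)).map (MvPolynomial.eval x) =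
      (h.toBlocks₁₁ + I • h.toBlocks₁₂)ᴴ * (h.toBlocks₁₁ - I • h.toBlocks₁₂) := by
  rw [Matrix.map_mul, Matrix.transpose_map, map_eval_cayleyFst_conj x MC h hC, map_eval_cayleySnd x MU h hU, transpose_map_conj_mul]

/-- **EVALUATION OF THE SYMBOLIC CONJUGATE SHILOV COORDINATE**: `(A + iB)ᵀ(Ā + iB̄) ↦ conj(c₁ᴴ c₂)` entrywise. [cite: Knapp1986, Ch. VII §1] -/
theorem map_eval_shilov_conj (hU : MU.map (MvPolynomial.eval x) = h) (hC : MC.map (MvPolynomial.eval x) = h.map (starRingEnd ℂ)) :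
    ((MU.toBlocks₁₁ + (MvPolynomial.C I : MvPolynomial σ ℂ) • MU.toBlocks₁₂)ᵀ * (MC.toBlocks₁₁ + (MvPolynomial.C I : MvPolynomial σ ℂ) • MC.toBlocks₁₂)).map (MvPolynomial.eval x) =
      ((h.toBlocks₁₁ + I • h.toBlocks₁₂)ᴴ * (h.toBlocks₁₁ - I • h.toBlocks₁₂)).map (starRingEnd ℂ) := by
  rw [Matrix.map_mul, Matrix.transpose_map, map_eval_cayleyFst x MU h hU, map_eval_cayleySnd_conj x MC h hC, transpose_mul_map_conj]

/-- **EVALUATION OF THE SYMBOLIC MULTIPLIER `χ_k`**: the polynomial «`det(Ā − iB̄)^k` if `k ≥ 0`, `det(A + iB)^{−k}` if `k < 0`» evaluates to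
`conj(det c₁)^k` whenever `conj(det c₁)·det c₁ = 1` (i.e. on `K_w`). [cite: Shimura1997, §16.4] -/
theorem eval_chiPoly (k : ℤ) (hU : MU.map (MvPolynomial.eval x) = h) (hC : MC.map (MvPolynomial.eval x) = h.map (starRingEnd ℂ))
    (hdet : conj (h.toBlocks₁₁ + I • h.toBlocks₁₂).det * (h.toBlocks₁₁ + I • h.toBlocks₁₂).det = 1) :
    MvPolynomial.eval x (if 0 ≤ k then (MC.toBlocks₁₁ - (MvPolynomial.C I : MvPolynomial σ ℂ) • MC.toBlocks₁₂).det ^ k.toNat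
      else (MU.toBlocks₁₁ + (MvPolynomial.C I : MvPolynomial σ ℂ) • MU.toBlocks₁₂).det ^ (-k).toNat) =
      conj (h.toBlocks₁₁ + I • h.toBlocks₁₂).det ^ k := by
  by_cases hk : 0 ≤ k
  · obtain ⟨m, rfl⟩ := Int.eq_ofNat_of_zero_le hk
    rw [if_pos hk, Int.toNat_natCast, map_pow, RingHom.map_det, RingHom.mapMatrix_apply, map_eval_cayleyFst_conj x MC h hC,
      ← RingHom.mapMatrix_apply, ← RingHom.map_det, zpow_natCast]
  · obtain ⟨m, rfl⟩ := Int.exists_eq_neg_ofNat (le_of_lt (not_le.1 hk))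
    rw [if_neg hk, neg_neg, Int.toNat_natCast, map_pow, RingHom.map_det, RingHom.mapMatrix_apply, map_eval_cayleyFst x MU h hU,
      conj_det_zpow_neg hdet]

/-- **EVALUATION OF THE SYMBOLIC CARRIER PART**: `P₁((Ā − iB̄)ᵀ(A − iB)) · det((A + iB)ᵀ(Ā + iB̄))^n ↦ P₁(c₁ᴴc₂) · conj(det(c₁ᴴc₂))^n`.
[cite: Knapp1986, Ch. VII §1] -/
theorem eval_carrierPoly (P₁ : MvPolynomial (Fin 2 × Fin 2) ℂ) (n : ℕ) (hU : MU.map (MvPolynomial.eval x) = h)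
    (hC : MC.map (MvPolynomial.eval x) = h.map (starRingEnd ℂ)) :
    MvPolynomial.eval x
        (MvPolynomial.aeval (fun kl : Fin 2 × Fin 2 =>
            ((MC.toBlocks₁₁ - (MvPolynomial.C I : MvPolynomial σ ℂ) • MC.toBlocks₁₂)ᵀ * (MU.toBlocks₁₁ - (MvPolynomial.C I : MvPolynomial σ ℂ) • MU.toBlocks₁₂)) kl.1 kl.2) P₁ *
          ((MU.toBlocks₁₁ + (MvPolynomial.C I : MvPolynomial σ ℂ) • MU.toBlocks₁₂)ᵀ * (MC.toBlocks₁₁ + (MvPolynomial.C I : MvPolynomial σ ℂ) • MC.toBlocks₁₂)).det ^ n) =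
      MvPolynomial.aeval (fun kl : Fin 2 × Fin 2 => ((h.toBlocks₁₁ + I • h.toBlocks₁₂)ᴴ * (h.toBlocks₁₁ - I • h.toBlocks₁₂)) kl.1 kl.2) P₁ *
        conj ((h.toBlocks₁₁ + I • h.toBlocks₁₂)ᴴ * (h.toBlocks₁₁ - I • h.toBlocks₁₂)).det ^ n := by
  have hv := map_eval_shilov x MU MC h hU hC
  have hvc := map_eval_shilov_conj x MU MC h hU hC
  rw [map_mul, map_pow, RingHom.map_det, RingHom.mapMatrix_apply, hvc, ← RingHom.mapMatrix_apply, ← RingHom.map_det]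
  congr 1
  rw [← MvPolynomial.aeval_eq_eval, MvPolynomial.comp_aeval_apply]
  refine congrArg (fun f : Fin 2 × Fin 2 → ℂ => MvPolynomial.aeval f P₁) (funext fun kl => ?_)
  rw [MvPolynomial.aeval_eq_eval, ← hv, Matrix.map_apply]

/-- **THE SYMBOLIC CLOSED FORM EVALUATES TO THE CLOSED FORM**: for ANY symbolic matrices `MU ↦ h`, `MC ↦ h̄` under `eval x`, and `h` with
`conj(det c₁(h))·det c₁(h) = 1`, the polynomial `χ-part · (P₁-part · det-part^n)` evaluates at `x` to `conj(det c₁)^k · (P₁(c₁ᴴc₂) · conj(det(c₁ᴴc₂))^n)`.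
[cite: Shimura1997, §16.4] [cite: Knapp1986, Ch. VII §1] -/
theorem eval_closedFormPoly (k : ℤ) (P₁ : MvPolynomial (Fin 2 × Fin 2) ℂ) (n : ℕ) (hU : MU.map (MvPolynomial.eval x) = h)
    (hC : MC.map (MvPolynomial.eval x) = h.map (starRingEnd ℂ))
    (hdet : conj (h.toBlocks₁₁ + I • h.toBlocks₁₂).det * (h.toBlocks₁₁ + I • h.toBlocks₁₂).det = 1) :
    MvPolynomial.eval x
        ((if 0 ≤ k then (MC.toBlocks₁₁ - (MvPolynomial.C I : MvPolynomial σ ℂ) • MC.toBlocks₁₂).det ^ k.toNat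
          else (MU.toBlocks₁₁ + (MvPolynomial.C I : MvPolynomial σ ℂ) • MU.toBlocks₁₂).det ^ (-k).toNat) *
          (MvPolynomial.aeval (fun kl : Fin 2 × Fin 2 =>
              ((MC.toBlocks₁₁ - (MvPolynomial.C I : MvPolynomial σ ℂ) • MC.toBlocks₁₂)ᵀ * (MU.toBlocks₁₁ - (MvPolynomial.C I : MvPolynomial σ ℂ) • MU.toBlocks₁₂)) kl.1 kl.2) P₁ *
            ((MU.toBlocks₁₁ + (MvPolynomial.C I : MvPolynomial σ ℂ) • MU.toBlocks₁₂)ᵀ * (MC.toBlocks₁₁ + (MvPolynomial.C I : MvPolynomial σ ℂ) • MC.toBlocks₁₂)).det ^ n)) =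
      conj (h.toBlocks₁₁ + I • h.toBlocks₁₂).det ^ k *
        (MvPolynomial.aeval (fun kl : Fin 2 × Fin 2 => ((h.toBlocks₁₁ + I • h.toBlocks₁₂)ᴴ * (h.toBlocks₁₁ - I • h.toBlocks₁₂)) kl.1 kl.2) P₁ *
          conj ((h.toBlocks₁₁ + I • h.toBlocks₁₂)ᴴ * (h.toBlocks₁₁ - I • h.toBlocks₁₂)).det ^ n) := by
  rw [map_mul, eval_chiPoly x MU MC h k hU hC hdet, eval_carrierPoly x MU MC h P₁ n hU hC]

end Symbolic

/-- **THE SYMBOLIC CLOSED FORM, PACKAGED**: for every weight `k`, numerator `P₁`, exponent `n` and every pair of symbolic matrices `(MU, MC)` over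
`MvPolynomial σ ℂ` there is ONE polynomial `P ∈ MvPolynomial σ ℂ` which, at EVERY point `x` where `(MU, MC)` evaluate to `(h, h̄)` with
`conj(det c₁(h))·det c₁(h) = 1`, evaluates to the closed form `conj(det c₁)^k · (P₁(c₁ᴴc₂) · conj(det(c₁ᴴc₂))^n)` (`c₁ = A + iB`, `c₂ = A − iB`,
`h = (A B; ∗ ∗)`).  [cite: Shimura1997, §16.4] [cite: Knapp1986, Ch. VII §1] -/
theorem exists_closedFormPoly {σ : Type*} (k : ℤ) (P₁ : MvPolynomial (Fin 2 × Fin 2) ℂ) (n : ℕ)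
    (MU MC : Matrix (Fin 2 ⊕ Fin 2) (Fin 2 ⊕ Fin 2) (MvPolynomial σ ℂ)) :
    ∃ P : MvPolynomial σ ℂ, ∀ (x : σ → ℂ) (h : Matrix (Fin 2 ⊕ Fin 2) (Fin 2 ⊕ Fin 2) ℂ), MU.map (MvPolynomial.eval x) = h →
      MC.map (MvPolynomial.eval x) = h.map (starRingEnd ℂ) →
      conj (h.toBlocks₁₁ + I • h.toBlocks₁₂).det * (h.toBlocks₁₁ + I • h.toBlocks₁₂).det = 1 →
        MvPolynomial.eval x P = conj (h.toBlocks₁₁ + I • h.toBlocks₁₂).det ^ k *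
          (MvPolynomial.aeval (fun kl : Fin 2 × Fin 2 => ((h.toBlocks₁₁ + I • h.toBlocks₁₂)ᴴ * (h.toBlocks₁₁ - I • h.toBlocks₁₂)) kl.1 kl.2) P₁ *
            conj ((h.toBlocks₁₁ + I • h.toBlocks₁₂)ᴴ * (h.toBlocks₁₁ - I • h.toBlocks₁₂)).det ^ n) :=
  ⟨_, fun x h hU hC hdet => eval_closedFormPoly x MU MC h k P₁ n hU hC hdet⟩

/-! ## §4 HEAD — the K-picture of a `Stab(i1)`-translate -/

/-- the symbolic product `X · k₀` evaluates at `(u, ū)` to `u · k₀`. [folklore] -/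
theorem map_eval_symbolicTranslate (u k₀ : Matrix (Fin 2 ⊕ Fin 2) (Fin 2 ⊕ Fin 2) ℂ) :
    ((Matrix.of fun p q : Fin 2 ⊕ Fin 2 =>
          (MvPolynomial.X (Sum.inl (p, q)) : MvPolynomial (((Fin 2 ⊕ Fin 2) × (Fin 2 ⊕ Fin 2)) ⊕ ((Fin 2 ⊕ Fin 2) × (Fin 2 ⊕ Fin 2))) ℂ)) *
        k₀.map MvPolynomial.C).map
      (MvPolynomial.eval (Sum.elim (fun pq : (Fin 2 ⊕ Fin 2) × (Fin 2 ⊕ Fin 2) => u pq.1 pq.2)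
        (fun pq : (Fin 2 ⊕ Fin 2) × (Fin 2 ⊕ Fin 2) => conj (u pq.1 pq.2)))) = u * k₀ := by
  rw [Matrix.map_mul]
  congr 1
  · ext p q
    simp
  · ext p q
    simp [MvPolynomial.eval_C]

/-- the symbolic product `X̄ · k̄₀` evaluates at `(u, ū)` to `conj(u · k₀)` entrywise. [folklore] -/
theorem map_eval_symbolicTranslate_conj (u k₀ : Matrix (Fin 2 ⊕ Fin 2) (Fin 2 ⊕ Fin 2) ℂ) :
    ((Matrix.of fun p q : Fin 2 ⊕ Fin 2 =>
          (MvPolynomial.X (Sum.inr (p, q)) : MvPolynomial (((Fin 2 ⊕ Fin 2) × (Fin 2 ⊕ Fin 2)) ⊕ ((Fin 2 ⊕ Fin 2) × (Fin 2 ⊕ Fin 2))) ℂ)) *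
        (k₀.map (starRingEnd ℂ)).map MvPolynomial.C).map
      (MvPolynomial.eval (Sum.elim (fun pq : (Fin 2 ⊕ Fin 2) × (Fin 2 ⊕ Fin 2) => u pq.1 pq.2)
        (fun pq : (Fin 2 ⊕ Fin 2) × (Fin 2 ⊕ Fin 2) => conj (u pq.1 pq.2)))) =
      (u * k₀).map (starRingEnd ℂ) := by
  rw [Matrix.map_mul, Matrix.map_mul]
  congr 1
  · ext p q
    simp
  · ext p q
    simp [MvPolynomial.eval_C]

/-- **THE K-PICTURE OF A `Stab(i1)`-TRANSLATE** (the `hKpic` bridge of `K2LiuKindWArchWhittakerLetter`, PAID).  For `k₀ ∈ K_w = Stab_{U(J)}(i1)`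
there is ONE polynomial `P` in the entries and the conjugate entries such that for EVERY `s`, EVERY section `F ∈ I_w(s, χ_k)`
(`χ_k(z) = (z̄∕‖z‖)^k`) whose compact picture on the coset section `v ↦ k_v = ½((1+v), −i(1−v); i(1−v), (1+v))` is `ev_v Q` (`Q ∈ 𝒜 = ℂ[u, D⁻¹]`),
and every `u ∈ K_w`: `F(u · k₀) = P(u, ū)`.  Proof: `Q = P₁∕D^n` (`IsLocalization.surj`); `u·k₀ ∈ K_w` (★ `mul_mem_UJ`, ★
`moeb_I_eq_I_iff_mem_unitaryGroup`); §2 closed form at `h = u·k₀`; §3 symbolic closed form at `MU = X·k₀`, `MC = X̄·k̄₀`.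
[cite: Shimura1997, §16.4] [cite: Knapp1986, Ch. VII §1] -/
theorem kPicture_rightTranslate (k : ℤ) (Q : Carrier) :
    ∀ k₀ : Matrix (Fin 2 ⊕ Fin 2) (Fin 2 ⊕ Fin 2) ℂ, k₀ᴴ * Matrix.J (Fin 2) ℂ * k₀ = Matrix.J (Fin 2) ℂ →
      moeb k₀ (I • (1 : Matrix (Fin 2) (Fin 2) ℂ)) = I • 1 →
      ∃ P : MvPolynomial (((Fin 2 ⊕ Fin 2) × (Fin 2 ⊕ Fin 2)) ⊕ ((Fin 2 ⊕ Fin 2) × (Fin 2 ⊕ Fin 2))) ℂ,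
        ∀ (s : ℂ) (F : Matrix (Fin 2 ⊕ Fin 2) (Fin 2 ⊕ Fin 2) ℂ → ℂ), IsArchSiegelSection (fun z : ℂ => (conj z / ((‖z‖ : ℝ) : ℂ)) ^ k) s F →
          (∀ (v : Matrix (Fin 2) (Fin 2) ℂ), vᴴ * v = 1 → ∀ hv : v.det ≠ 0,
            F ((2 : ℂ)⁻¹ • fromBlocks (1 + v) (-(I • (1 - v))) (I • (1 - v)) (1 + v) : Matrix (Fin 2 ⊕ Fin 2) (Fin 2 ⊕ Fin 2) ℂ) = evalAt v hv Q) →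
          ∀ u : Matrix (Fin 2 ⊕ Fin 2) (Fin 2 ⊕ Fin 2) ℂ, uᴴ * Matrix.J (Fin 2) ℂ * u = Matrix.J (Fin 2) ℂ → moeb u (I • (1 : Matrix (Fin 2) (Fin 2) ℂ)) = I • 1 →
            F (u * k₀) = MvPolynomial.eval (Sum.elim (fun pq => u pq.1 pq.2) (fun pq => conj (u pq.1 pq.2))) P := by
  intro k₀ hk₀ hIk₀
  -- `Q = P₁ / D^n`
  obtain ⟨⟨P₁, D⟩, hsurj⟩ := IsLocalization.surj (Submonoid.powers detPoly) Q
  obtain ⟨n, hn⟩ := (Submonoid.mem_powers_iff _ _).1 D.2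
  have hP₁ : Q * algebraMap (MvPolynomial (Fin 2 × Fin 2) ℂ) Carrier (detPoly ^ n) = algebraMap (MvPolynomial (Fin 2 × Fin 2) ℂ) Carrier P₁ := by
    rw [hn]
    exact hsurj
  -- ONE polynomial from the symbolic closed form at the symbolic translate `MU = X·k₀`, `MC = X̄·k̄₀`
  obtain ⟨P, hP⟩ := exists_closedFormPoly k P₁ n
    ((Matrix.of fun p q : Fin 2 ⊕ Fin 2 =>
        (MvPolynomial.X (Sum.inl (p, q)) : MvPolynomial (((Fin 2 ⊕ Fin 2) × (Fin 2 ⊕ Fin 2)) ⊕ ((Fin 2 ⊕ Fin 2) × (Fin 2 ⊕ Fin 2))) ℂ)) *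
      k₀.map MvPolynomial.C)
    ((Matrix.of fun p q : Fin 2 ⊕ Fin 2 =>
        (MvPolynomial.X (Sum.inr (p, q)) : MvPolynomial (((Fin 2 ⊕ Fin 2) × (Fin 2 ⊕ Fin 2)) ⊕ ((Fin 2 ⊕ Fin 2) × (Fin 2 ⊕ Fin 2))) ℂ)) *
      (k₀.map (starRingEnd ℂ)).map MvPolynomial.C)
  refine ⟨P, ?_⟩
  intro s F hF hQ u hu hI
  -- `h = u · k₀ ∈ K_w`
  have hh : (u * k₀)ᴴ * Matrix.J (Fin 2) ℂ * (u * k₀) = Matrix.J (Fin 2) ℂ := mul_mem_UJ hu hk₀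
  have hhI : moeb (u * k₀) (I • (1 : Matrix (Fin 2) (Fin 2) ℂ)) = I • 1 :=
    moeb_I_eq_I_of_mem_unitaryGroup hh (Submonoid.mul_mem _ (mem_unitaryGroup_of_stab hu hI) (mem_unitaryGroup_of_stab hk₀ hIk₀))
  obtain ⟨hc₁, -⟩ := cayley_mem_unitaryGroup hh hhI
  have hc₁' : ((u * k₀).toBlocks₁₁ + I • (u * k₀).toBlocks₁₂)ᴴ * ((u * k₀).toBlocks₁₁ + I • (u * k₀).toBlocks₁₂) = 1 := by
    have h := Matrix.mem_unitaryGroup_iff'.1 hc₁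
    rwa [star_eq_conjTranspose] at h
  rw [apply_of_stab_eq hF hQ hP₁ hh hhI,
    hP _ (u * k₀) (map_eval_symbolicTranslate u k₀) (map_eval_symbolicTranslate_conj u k₀) (conj_det_mul_det_eq_one hc₁')]

end Summit.HodgeConjecture.HodgeConjecture.Cruxes.HLiu418.K2LiuKindWArchWhittakerKPicture

end
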